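import Summits.CriticalPhenomena.PercolationContinuityZ3.Theorems.PercNearOneGluingNoHeavyQuantDIBStarCorner
import HarnessLib

/-!
# QUANT lane R8, Conjecture DIB\* — SCOPE of the typed row `Quant.IndepBlob.DIBStar x`: it HOLDS at the floor `x = 1` and FAILS at every
# floor `x > 1` (an artefact of the discount `κ_x(g) = (g − x²)/(1 − x)`, positive there); so the open range is exactly `1/2 < x < 1`

builds on p205010 (kernel theorem, internal audit signed; external expert review pending)

Support file (`--supports stmt-CriticalPhenomena-4575`), QUANT lane typer seat prim-quant-stmt (gen 19); typer brief (c) "parametrised so refuted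
variants can be recorded as negations".  Theorems only, no sorries, standard axioms.

`Quant.IndepBlob.DIBStar x` (`…QuantDIBStar`, typer g17) is stated for every real `x`; the lane's theorems cover `x ≤ 1/2`
(`DIBStar.of_le_half`), `1/2 < x ≤ 1` modulo the corner (`DIBStar.of_corner`), and `x < 1 ↔ StepLemmaFS` (lead g17).  Two bookkeeping facts
so that no seat attacks or cites the row outside its meaningful range:
* `Quant.IndepBlob.dibStarCorner_one`, **`dibStar_one`** — at `x = 1` the corner is EMPTY (in the kernel's arithmetic `κ_1 = 0`, so the discounted
  credit is at most the heavy total `≤ 2j`), hence `DIBStar 1` holds outright;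
* **`Quant.IndepBlob.not_dibStar_of_one_lt`** — for `x > 1` the row is FALSE: one blob of size `1` and gate `1` at layer `j = 1` is 'light'
  (`1 < x`) with credit `κ_x(1) = 1 + x > 2 = 2j`, while `P(N ≥ 2) = 0 < x`.
So the typed conjecture is open exactly on `1/2 < x < 1` (README V192: its corner `DIBStarCorner x`).

[this work]; the gluing rows served [cite: KozmaNitzan2024, Conjecture 3 (p. 15)].
-/

namespace Summit.CriticalPhenomena.PercolationContinuityZ3.Theorems

namespace Quant

namespace IndepBlob

open Finset

/-- **The corner is empty at floor `1`**: with `κ_1(g) = (g − 1)/(1 − 1) = 0` the discounted credit is `Σ_{g k = 1} a k ≤` the heavy total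
`≤ 2j`, contradicting `credit > 2j`; so `DIBStarCorner 1`. [this work] -/
theorem dibStarCorner_one : DIBStarCorner 1 := by
  intro ι _ _ a g j hg _ hcorner _ hcredit
  exfalso
  have hle : ∑ k, (a k : ℝ) * (if (1 : ℝ) ≤ g k then g k else (g k - 1 ^ 2) / (1 - 1)) ≤
      ∑ k ∈ Finset.univ.filter (fun k => (1 : ℝ) ≤ g k), (a k : ℝ) := by
    rw [Finset.sum_filter]
    refine Finset.sum_le_sum fun k _ => ?_
    by_cases hk : (1 : ℝ) ≤ g k
    · rw [if_pos hk, if_pos hk]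
      exact mul_le_of_le_one_right (Nat.cast_nonneg _) (hg k).2
    · simp only [if_neg hk, sub_self, div_zero, mul_zero, le_refl]
  have hnat : ((∑ k ∈ Finset.univ.filter (fun k => (1 : ℝ) ≤ g k), a k : ℕ) : ℝ) ≤ ((2 * j : ℕ) : ℝ) := by
    exact_mod_cast hcorner
  push_cast at hnat
  linarith

/-- **Conjecture DIB\* holds at the floor `x = 1`** (`DIBStar.of_corner` with the empty corner `dibStarCorner_one`). [this work] -/
theorem dibStar_one : DIBStar 1 :=
  DIBStar.of_corner (by norm_num) le_rfl dibStarCorner_one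

/-- **The typed row is FALSE at every floor `x > 1`** (scope artefact, not a refutation of Conjecture DIB\*, whose range is `x < 1`): one blob
of size `1`, gate `1`, layer `j = 1` — it is 'light' (`1 < x`), its credit `(1 − x²)/(1 − x) = 1 + x` exceeds `2j = 2`, and `P(N ≥ 2) = 0 < x`.
[this work] -/
theorem not_dibStar_of_one_lt {x : ℝ} (hx : 1 < x) : ¬ DIBStar x := by
  intro h
  have row := h Unit (fun _ => 1) (fun _ => 1) 1 (fun _ => ⟨zero_le_one, le_rfl⟩) (fun _ _ => le_rfl) (by
    rw [Fintype.sum_unique, if_neg (not_le.2 hx), Nat.cast_one, one_mul]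
    have h1x : (1 : ℝ) - x ≠ 0 := by linarith
    rw [lt_div_iff_of_neg (by linarith)]
    nlinarith)
  -- the tail `P(N ≥ 2)` of one unit blob vanishes
  have hzero : ∑ W : Finset Unit, (∏ k, if k ∈ W then (fun _ : Unit => (1 : ℝ)) k else 1 - (fun _ : Unit => (1 : ℝ)) k) *
      (if 1 + 1 ≤ ∑ k ∈ W, (fun _ : Unit => 1) k then (1 : ℝ) else 0) = 0 := by
    refine Finset.sum_eq_zero fun W _ => ?_
    have hW : ∑ k ∈ W, (fun _ : Unit => 1) k ≤ 1 := by
      calc ∑ k ∈ W, (fun _ : Unit => 1) k ≤ ∑ k ∈ (Finset.univ : Finset Unit), (fun _ : Unit => 1) k :=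
            Finset.sum_le_sum_of_subset_of_nonneg (Finset.subset_univ W) (fun _ _ _ => Nat.zero_le _)
        _ = 1 := by simp
    rw [if_neg (by omega), mul_zero]
  rw [hzero] at row
  linarith

end IndepBlob

end Quant

end Summit.CriticalPhenomena.PercolationContinuityZ3.Theorems
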